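import Summits.CriticalPhenomena.PercolationContinuityZ3.Theorems.PercNearOneGluingNoHeavyLowerTailThreePartitionJuntaAndVar
import Summits.CriticalPhenomena.PercolationContinuityZ3.Theorems.PercNearOneGluingNoHeavyLowerTailThreePartitionOneOr
import HarnessLib.Audit

/-!
# `NoHeavyLowerTail` (crux stmt-CriticalPhenomena-4575), master-family hierarchy P3 (gen 38): the TWISTED K* — an explicit pure diagonal certificate for the
# DISJUNCTION junta `OR_Q` at every twist meeting the block (bookkeeping half: the weights, condition (ii), nonnegativity, the fibre identity)

Support file (seat `prim-masterthm-p3`; `--supports stmt-CriticalPhenomena-4575`; memo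
`run/shared/lean/prim/prim-masterthm/FROM-prim-masterthm-p3-g38-PDC-STRUCTURE.md` §5bis).  Block `Q`, twist `τ` with `T := τ ∩ Q ≠ ∅`, `𝔘 = nonemptyFam`
(so `liftQ Q 𝔘 = orFam Q`).  THE CERTIFICATE ('merge the `∅`-deficit into one twisted singleton'): for `x₀ ∈ T`,
`orKappa τ Q x₀ m = Σ_P eJ(P)·[mergeEmptyAt x₀ (qc₃P) = m]` with `mergeEmptyAt x₀ ∅ = {x₀}`, `mergeEmptyAt x₀ m = m` otherwise; i.e. `κ(m) = e'_τ(m)` for `m ∉ {∅, {x₀}}`,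
`κ(∅) = 0`, `κ({x₀}) = e'_τ({x₀}) + e'_τ(∅)`.  THIS FILE: `sum_orKappa_mul_indZ` (the diagonal form of `κ` is the one-copy pattern sum with merged third part),
`orKappa_le_one` (condition (ii): merging only moves the negative `∅`-tokens up), `sum_indZ_qc₃_eq` (pattern counts `#{P : qc₃P = S}` as sums over the first part),
`orKappa_nonneg`, and the FIBRE IDENTITY `sum_top_sub_two_eq_sum_klCube`: `Σ_P ([qc₃ ∈ 𝔄∩𝔅] − [qc₂ ∈ 𝔄][qc₃ ∈ 𝔅]) = Σ_{u ⊆ Q} klCube 𝔅ᵤ 𝔄ᵤ (Q \\ u)` with the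
SHIFTED signatures `𝔄ᵤ = {y : y ∪ (T ∩ u) ∈ 𝔄}` (per fibre `P₁ = u` the substitution `y = P₃ ∆ (T \\ u)` turns the twisted pair `(qc₂, qc₃)` into a complementary pair of
the cube `2^{Q∖u}` shifted by `T ∩ u`).  Condition (i) and the certificate theorem are in `…ThreePartitionOneOrTwistedCert`.  HONEST LABEL: an explicit all-`k`
certificate (the twisted analogue of gen 37's `K*`); with `DiagCert.andVar` it gives COMB-C3 for `(OR_Q ∧ AND_J, A, B)` for all `Q, J`; the general conjecture stays OPEN.
[this work]
-/

noncomputable section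

open Finset
open scoped symmDiff Classical

namespace Summit.CriticalPhenomena.PercolationContinuityZ3.Theorems.ThreePartition

variable {ι : Type*} [Fintype ι]

/-! ## The disjunction as a junta, the merged weights -/

omit [Fintype ι] in
/-- The family of nonempty parts (the disjunction read on the block). [this work] -/
def nonemptyFam : Set (Set ι) := {m | m.Nonempty}

omit [Fintype ι] in
/-- Membership in `nonemptyFam`. [this work] -/
@[simp] theorem mem_nonemptyFam {m : Set ι} : m ∈ (nonemptyFam : Set (Set ι)) ↔ m.Nonempty := Iff.rfl

omit [Fintype ι] in
/-- `nonemptyFam` is an up-set. [this work] -/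
theorem isUpperSet_nonemptyFam : IsUpperSet (nonemptyFam : Set (Set ι)) := fun _ _ hab ha => Set.Nonempty.mono hab ha

omit [Fintype ι] in
/-- The junta of `nonemptyFam` on `Q` is the disjunction `orFam Q`. [this work] -/
theorem liftQ_nonemptyFam (Q : Set ι) : liftQ Q (nonemptyFam : Set (Set ι)) = orFam Q := by
  ext x; rw [mem_liftQ, mem_nonemptyFam, mem_orFam]

omit [Fintype ι] in
/-- Merging the empty part into the singleton `{x₀}`. [this work] -/
def mergeEmptyAt (x₀ : ι) (m : Set ι) : Set ι := if m = ∅ then {x₀} else m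

omit [Fintype ι] in
/-- `mergeEmptyAt x₀ ∅ = {x₀}`. [this work] -/
theorem mergeEmptyAt_empty (x₀ : ι) : mergeEmptyAt x₀ (∅ : Set ι) = {x₀} := by unfold mergeEmptyAt; rw [if_pos rfl]

omit [Fintype ι] in
/-- `mergeEmptyAt x₀ m = m` for `m ≠ ∅`. [this work] -/
theorem mergeEmptyAt_of_ne (x₀ : ι) {m : Set ι} (hm : m ≠ ∅) : mergeEmptyAt x₀ m = m := by unfold mergeEmptyAt; rw [if_neg hm]

omit [Fintype ι] in
/-- `mergeEmptyAt x₀ m` is never empty. [this work] -/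
theorem mergeEmptyAt_nonempty (x₀ : ι) (m : Set ι) : (mergeEmptyAt x₀ m).Nonempty := by
  by_cases hm : m = ∅
  · rw [hm, mergeEmptyAt_empty]; exact Set.singleton_nonempty _
  · rw [mergeEmptyAt_of_ne x₀ hm]; exact Set.nonempty_iff_ne_empty.2 hm

omit [Fintype ι] in
/-- `mergeEmptyAt x₀ m ⊆ Q` when `m ⊆ Q` and `x₀ ∈ Q`. [this work] -/
theorem mergeEmptyAt_subset {x₀ : ι} {Q m : Set ι} (hx₀ : x₀ ∈ Q) (hm : m ⊆ Q) : mergeEmptyAt x₀ m ⊆ Q := by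
  by_cases h : m = ∅
  · rw [h, mergeEmptyAt_empty]; exact Set.singleton_subset_iff.2 hx₀
  · rw [mergeEmptyAt_of_ne x₀ h]; exact hm

omit [Fintype ι] in
/-- An up-set containing `m` contains `mergeEmptyAt x₀ m`. [this work] -/
theorem mergeEmptyAt_mem_of_mem {x₀ : ι} {𝔇 : Set (Set ι)} (h𝔇 : IsUpperSet 𝔇) {m : Set ι} (hm : m ∈ 𝔇) : mergeEmptyAt x₀ m ∈ 𝔇 := by
  by_cases h : m = ∅
  · rw [h, mergeEmptyAt_empty]; rw [h] at hm; exact h𝔇 (Set.empty_subset _) hm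
  · rw [mergeEmptyAt_of_ne x₀ h]; exact hm

section Weights

variable (τ Q : Set ι) (x₀ : ι)

/-- **The twisted K* weights** for the disjunction: `κ(m) = Σ_P eJ(P)·[mergeEmptyAt x₀ (qc₃ P) = m]`. [this work] -/
def orKappa (m : Set ι) : ℤ := ∑ P ∈ cfgsIn Q, eJ τ Q nonemptyFam P * indZ (mergeEmptyAt x₀ (qc₃ τ Q P) = m)

/-- **Diagonal form of `orKappa`**: `Σ_{m ⊆ Q} κ(m)[m ∈ 𝔄 ∩ 𝔅] = Σ_P eJ(P)[mergeEmptyAt x₀ (qc₃P) ∈ 𝔄 ∩ 𝔅]` (`x₀ ∈ Q`). [this work] -/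
theorem sum_orKappa_mul_indZ (hx₀ : x₀ ∈ Q) (𝔄 𝔅 : Set (Set ι)) :
    ∑ m ∈ subsetsOf Q, orKappa τ Q x₀ m * indZ (m ∈ 𝔄 ∧ m ∈ 𝔅)
      = ∑ P ∈ cfgsIn Q, eJ τ Q nonemptyFam P * indZ (mergeEmptyAt x₀ (qc₃ τ Q P) ∈ 𝔄 ∧ mergeEmptyAt x₀ (qc₃ τ Q P) ∈ 𝔅) := by
  unfold orKappa
  simp_rw [sum_mul]
  rw [sum_comm]
  refine sum_congr rfl fun P _ => ?_
  rw [← sum_filter_add_sum_filter_not (subsetsOf Q) (fun m => m = mergeEmptyAt x₀ (qc₃ τ Q P))]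
  have hzero : ∑ m ∈ (subsetsOf Q).filter (fun m => ¬ m = mergeEmptyAt x₀ (qc₃ τ Q P)),
      eJ τ Q nonemptyFam P * indZ (mergeEmptyAt x₀ (qc₃ τ Q P) = m) * indZ (m ∈ 𝔄 ∧ m ∈ 𝔅) = 0 :=
    sum_eq_zero fun m hm => by
      rw [mem_filter] at hm
      rw [indZ_of_neg (fun h => hm.2 h.symm), mul_zero, zero_mul]
  have hone : (subsetsOf Q).filter (fun m => m = mergeEmptyAt x₀ (qc₃ τ Q P)) = {mergeEmptyAt x₀ (qc₃ τ Q P)} := by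
    ext m; simp only [mem_filter, mem_subsetsOf, mem_singleton]
    exact ⟨fun h => h.2, fun h => ⟨h ▸ mergeEmptyAt_subset hx₀ (qc₃_subset τ Q P), h⟩⟩
  rw [hzero, add_zero, hone, sum_singleton, indZ_of_pos rfl, mul_one]

/-- **Condition (ii) for the twisted K*** (any up-sets, any twist): merging only relocates the negative `∅`-tokens upwards. [this work] -/
theorem orKappa_le_one (hx₀ : x₀ ∈ Q) {𝔄 𝔅 : Set (Set ι)} (h𝔄 : IsUpperSet 𝔄) (h𝔅 : IsUpperSet 𝔅) :
    ∑ m ∈ subsetsOf Q, orKappa τ Q x₀ m * indZ (m ∈ 𝔄 ∧ m ∈ 𝔅)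
      ≤ ∑ P ∈ cfgsIn Q, eJ τ Q nonemptyFam P * indZ (qc₃ τ Q P ∈ 𝔄 ∧ qc₃ τ Q P ∈ 𝔅) := by
  rw [sum_orKappa_mul_indZ τ Q x₀ hx₀]
  refine sum_le_sum fun P _ => ?_
  by_cases h : qc₃ τ Q P = ∅
  · -- the token is negative and the merged part is larger
    have he : eJ τ Q nonemptyFam P ≤ 0 := by
      unfold eJ; rw [h, indZ_of_neg (fun h' : (∅ : Set ι) ∈ (nonemptyFam : Set (Set ι)) => Set.not_nonempty_empty h')]
      have := indZ_nonneg (qc₁ τ Q P ∈ (nonemptyFam : Set (Set ι))); linarith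
    refine mul_le_mul_of_nonpos_left (indZ_le_indZ_of_imp fun hh => ?_) he
    exact ⟨mergeEmptyAt_mem_of_mem h𝔄 hh.1, mergeEmptyAt_mem_of_mem h𝔅 hh.2⟩
  · rw [mergeEmptyAt_of_ne x₀ h]

/-- **Pattern counts by the third part**: `Σ_P [qc₃P = S] = #{u ⊆ Q : S ∆ (τ∩Q) ⊆ Q \ u}` (the first part avoids `S ∆ T`; then `P₃ = S ∆ T`). [this work] -/
theorem sum_indZ_qc₃_eq (S : Set ι) :
    ∑ P ∈ cfgsIn Q, indZ (qc₃ τ Q P = S) = ∑ u ∈ subsetsOf Q, indZ (S ∆ (τ ∩ Q) ⊆ Q \ u) := by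
  rw [sum_cfgsIn_eq_patSum]
  unfold patSum
  refine sum_congr rfl fun u _ => ?_
  have key : ∀ a ∈ subsetsOf (Q \ u), indZ (qc₃ τ Q (u, (Q \ u) \ a) = S) = indZ (a = S ∆ (τ ∩ Q)) := by
    intro a ha
    rw [mem_subsetsOf] at ha
    unfold qc₃; rw [pt₃_mk ha]
    exact indZ_congr ⟨fun h => by rw [← h, symmDiff_symmDiff_cancel_right], fun h => by rw [h, symmDiff_symmDiff_cancel_right]⟩
  rw [sum_congr rfl key, ← sum_filter_add_sum_filter_not (subsetsOf (Q \ u)) (fun a => a = S ∆ (τ ∩ Q))]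
  have hzero : ∑ a ∈ (subsetsOf (Q \ u)).filter (fun a => ¬ a = S ∆ (τ ∩ Q)), indZ (a = S ∆ (τ ∩ Q)) = 0 :=
    sum_eq_zero fun a ha => indZ_of_neg (mem_filter.1 ha).2
  rw [hzero, add_zero]
  by_cases hS : S ∆ (τ ∩ Q) ⊆ Q \ u
  · have hone : (subsetsOf (Q \ u)).filter (fun a => a = S ∆ (τ ∩ Q)) = {S ∆ (τ ∩ Q)} := by
      ext a; simp only [mem_filter, mem_subsetsOf, mem_singleton]
      exact ⟨fun h => h.2, fun h => ⟨h ▸ hS, h⟩⟩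
    rw [hone, sum_singleton, indZ_of_pos rfl, indZ_of_pos hS]
  · have hnone : (subsetsOf (Q \ u)).filter (fun a => a = S ∆ (τ ∩ Q)) = ∅ := by
      ext a; simp only [mem_filter, mem_subsetsOf, Finset.notMem_empty, iff_false, not_and]
      intro ha h; exact hS (h ▸ ha)
    rw [hnone, sum_empty, indZ_of_neg hS]

/-- **`orKappa ≥ 0`** (`x₀ ∈ τ ∩ Q`): off `{x₀}` every contributing token is positive; at `{x₀}` the `#{P : qc₃P = ∅}` negative tokens are outnumbered by the
positive tokens with `qc₃P = {x₀}`. [this work] -/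
theorem orKappa_nonneg (hx₀ : x₀ ∈ τ ∩ Q) (m : Set ι) : 0 ≤ orKappa τ Q x₀ m := by
  have heJ_pos : ∀ P ∈ cfgsIn Q, qc₃ τ Q P ≠ ∅ → 1 ≤ eJ τ Q nonemptyFam P := fun P _ h => by
    unfold eJ; rw [indZ_of_pos (p := qc₃ τ Q P ∈ (nonemptyFam : Set (Set ι))) (Set.nonempty_iff_ne_empty.2 h)]
    have := indZ_le_one (qc₁ τ Q P ∈ (nonemptyFam : Set (Set ι))); linarith
  have heJ_neg : ∀ P ∈ cfgsIn Q, qc₃ τ Q P = ∅ → -1 ≤ eJ τ Q nonemptyFam P := fun P _ h => by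
    unfold eJ; rw [h, indZ_of_neg (fun h' : (∅ : Set ι) ∈ (nonemptyFam : Set (Set ι)) => Set.not_nonempty_empty h')]
    have := indZ_le_one (qc₁ τ Q P ∈ (nonemptyFam : Set (Set ι))); linarith
  unfold orKappa
  by_cases hm : m = {x₀}
  · -- compare with the token counts
    have hlow : ∀ P ∈ cfgsIn Q, indZ (qc₃ τ Q P = {x₀}) - indZ (qc₃ τ Q P = ∅) ≤ eJ τ Q nonemptyFam P * indZ (mergeEmptyAt x₀ (qc₃ τ Q P) = m) := by
      intro P hP
      by_cases h0 : qc₃ τ Q P = ∅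
      · rw [indZ_of_neg (fun h : qc₃ τ Q P = {x₀} => by rw [h0] at h; exact (Set.singleton_nonempty x₀).ne_empty h.symm), indZ_of_pos h0,
          h0, mergeEmptyAt_empty, indZ_of_pos hm.symm, mul_one]
        have := heJ_neg P hP h0; linarith
      · rw [indZ_of_neg h0, sub_zero, mergeEmptyAt_of_ne x₀ h0]
        by_cases h1 : qc₃ τ Q P = {x₀}
        · rw [indZ_of_pos h1, indZ_of_pos (h1.trans hm.symm), mul_one]; exact heJ_pos P hP h0
        · rw [indZ_of_neg h1, indZ_of_neg (fun h => h1 (h.trans hm)), mul_zero]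
    refine le_trans ?_ (sum_le_sum hlow)
    rw [sum_sub_distrib, sum_indZ_qc₃_eq, sum_indZ_qc₃_eq, sub_nonneg]
    refine sum_le_sum fun u _ => indZ_le_indZ_of_imp fun h => ?_
    -- `∅ ∆ T = T ⊇ {x₀} ∆ T`
    refine Set.Subset.trans (fun c hc => ?_) h
    rw [Set.mem_symmDiff] at hc ⊢
    rcases hc with ⟨hc1, hc2⟩ | ⟨hc1, _⟩
    · exact absurd (by rw [Set.mem_singleton_iff.1 hc1]; exact hx₀) hc2
    · exact Or.inr ⟨hc1, fun h0 => h0⟩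
  · refine sum_nonneg fun P hP => ?_
    by_cases h0 : qc₃ τ Q P = ∅
    · rw [h0, mergeEmptyAt_empty, indZ_of_neg (fun h : ({x₀} : Set ι) = m => hm h.symm), mul_zero]
    · rw [mergeEmptyAt_of_ne x₀ h0]
      exact mul_nonneg (by have := heJ_pos P hP h0; linarith) (indZ_nonneg _)

end Weights

/-! ## The fibre identity: twisted top-minus-two counts are sums of shifted sub-cube Kleitman slacks -/

section Fibre

variable (τ Q : Set ι)

omit [Fintype ι] in
/-- Splitting the twist along a fibre: for `a ⊆ Q \ u` and `T ⊆ Q`, `a ∆ T = (a ∆ (T \ u)) ∪ (T ∩ u)`. [this work] -/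
theorem symmDiff_eq_union_fibre {Q u a T : Set ι} (ha : a ⊆ Q \ u) : a ∆ T = (a ∆ (T \ u)) ∪ (T ∩ u) := by
  ext c; simp only [Set.mem_symmDiff, Set.mem_union, Set.mem_sdiff, Set.mem_inter_iff]
  constructor
  · rintro (⟨hca, hcT⟩ | ⟨hcT, hca⟩)
    · exact Or.inl (Or.inl ⟨hca, fun h => hcT h.1⟩)
    · by_cases hcu : c ∈ u
      · exact Or.inr ⟨hcT, hcu⟩
      · exact Or.inl (Or.inr ⟨⟨hcT, hcu⟩, hca⟩)
  · rintro ((⟨hca, hn⟩ | ⟨⟨hcT, hcu⟩, hca⟩) | ⟨hcT, hcu⟩)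
    · exact Or.inl ⟨hca, fun hcT => hn ⟨hcT, (ha hca).2⟩⟩
    · exact Or.inr ⟨hcT, hca⟩
    · exact Or.inr ⟨hcT, fun hca => (ha hca).2 hcu⟩

omit [Fintype ι] in
/-- The complementary part along a fibre: for `a ⊆ F := Q \ u`, `T ⊆ Q`: `(F \ a) ∆ T = (F \ (a ∆ (T \ u))) ∪ (T ∩ u)`. [this work] -/
theorem sdiff_symmDiff_eq_union_fibre {Q u T : Set ι} (a : Set ι) (hT : T ⊆ Q) :
    ((Q \ u) \ a) ∆ T = ((Q \ u) \ (a ∆ (T \ u))) ∪ (T ∩ u) := by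
  have h1 := symmDiff_eq_union_fibre (a := (Q \ u) \ a) (u := u) (Q := Q) (T := T) Set.sdiff_subset
  rw [h1]
  congr 1
  ext c; simp only [Set.mem_symmDiff, Set.mem_sdiff]
  constructor
  · rintro (⟨⟨hcF, hca⟩, hn⟩ | ⟨⟨hcT, hcu⟩, hn⟩)
    · exact ⟨hcF, fun h => h.elim (fun h1 => hca h1.1) fun h2 => hn h2.1⟩
    · refine ⟨⟨hT hcT, hcu⟩, fun h => h.elim (fun h1 => h1.2 ⟨hcT, hcu⟩) fun h2 => hn ⟨⟨hT hcT, hcu⟩, h2.2⟩⟩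
  · rintro ⟨hcF, hn⟩
    by_cases hca : c ∈ a
    · right; exact ⟨by_contra fun h => hn (Or.inl ⟨hca, h⟩), fun h => h.2 hca⟩
    · left; exact ⟨⟨hcF, hca⟩, fun h => hn (Or.inr ⟨h, hca⟩)⟩

/-- Re-indexing a fibre sum by the involution `a ↦ a ∆ S` of `2^F` (`S ⊆ F`). [this work] -/
theorem sum_subsetsOf_symmDiff (F S : Set ι) (hS : S ⊆ F) (g : Set ι → ℤ) :
    ∑ a ∈ subsetsOf F, g (a ∆ S) = ∑ a ∈ subsetsOf F, g a := by
  refine Finset.sum_bij' (fun a _ => a ∆ S) (fun a _ => a ∆ S) ?_ ?_ ?_ ?_ (fun _ _ => rfl)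
  · intro a ha; rw [mem_subsetsOf] at ha ⊢; exact fun c hc => (Set.mem_symmDiff.1 hc).elim (fun h => ha h.1) fun h => hS h.1
  · intro a ha; rw [mem_subsetsOf] at ha ⊢; exact fun c hc => (Set.mem_symmDiff.1 hc).elim (fun h => ha h.1) fun h => hS h.1
  · intro a _; exact symmDiff_symmDiff_cancel_right _ _
  · intro a _; exact symmDiff_symmDiff_cancel_right _ _

/-- The SHIFTED SIGNATURE on the fibre `P₁ = u`: `{y : y ∪ (T ∩ u) ∈ 𝔄}`. [this work] -/
def shiftFam (T u : Set ι) (𝔄 : Set (Set ι)) : Set (Set ι) := {y | y ∪ (T ∩ u) ∈ 𝔄}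

omit [Fintype ι] in
/-- Membership in `shiftFam`. [this work] -/
@[simp] theorem mem_shiftFam {T u : Set ι} {𝔄 : Set (Set ι)} {y : Set ι} : y ∈ shiftFam T u 𝔄 ↔ y ∪ (T ∩ u) ∈ 𝔄 := Iff.rfl

omit [Fintype ι] in
/-- Shifted up-sets are up-sets. [this work] -/
theorem isUpperSet_shiftFam (T u : Set ι) {𝔄 : Set (Set ι)} (h𝔄 : IsUpperSet 𝔄) : IsUpperSet (shiftFam T u 𝔄) :=
  fun _ _ hab ha => h𝔄 (Set.union_subset_union_left _ hab) ha

omit [Fintype ι] in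
/-- On a fibre avoiding `T` the shift is trivial. [this work] -/
theorem shiftFam_of_disjoint {T u : Set ι} (h : T ∩ u = ∅) (𝔄 : Set (Set ι)) : shiftFam T u 𝔄 = 𝔄 := by
  ext y; rw [mem_shiftFam, h, Set.union_empty]

/-- **THE FIBRE IDENTITY** (`T = τ ∩ Q`): `Σ_P ([qc₃P ∈ 𝔄 ∩ 𝔅] − [qc₂P ∈ 𝔄][qc₃P ∈ 𝔅]) = Σ_{u ⊆ Q} klCube 𝔅ᵤ 𝔄ᵤ (Q \ u)`,
`𝔄ᵤ = shiftFam T u 𝔄`. [this work] -/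
theorem sum_top_sub_two_eq_sum_klCube (𝔄 𝔅 : Set (Set ι)) :
    ∑ P ∈ cfgsIn Q, (indZ (qc₃ τ Q P ∈ 𝔄 ∧ qc₃ τ Q P ∈ 𝔅) - indZ (qc₂ τ Q P ∈ 𝔄 ∧ qc₃ τ Q P ∈ 𝔅))
      = ∑ u ∈ subsetsOf Q, klCube (shiftFam (τ ∩ Q) u 𝔅) (shiftFam (τ ∩ Q) u 𝔄) (Q \ u) := by
  rw [sum_cfgsIn_eq_patSum]
  unfold patSum
  refine sum_congr rfl fun u hu => ?_
  rw [mem_subsetsOf] at hu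
  dsimp only
  rw [klCube_eq_sum]
  have hT : τ ∩ Q ⊆ Q := Set.inter_subset_right
  have hS : (τ ∩ Q) \ u ⊆ Q \ u := Set.sdiff_subset_sdiff_left hT
  rw [← sum_subsetsOf_symmDiff (Q \ u) ((τ ∩ Q) \ u) hS
    (fun a => indZ (a ∈ shiftFam (τ ∩ Q) u 𝔅 ∧ a ∈ shiftFam (τ ∩ Q) u 𝔄) - indZ (a ∈ shiftFam (τ ∩ Q) u 𝔅 ∧ (Q \ u) \ a ∈ shiftFam (τ ∩ Q) u 𝔄))]
  refine sum_congr rfl fun a ha => ?_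
  rw [mem_subsetsOf] at ha
  have e3 : qc₃ τ Q (u, (Q \ u) \ a) = (a ∆ ((τ ∩ Q) \ u)) ∪ ((τ ∩ Q) ∩ u) := by
    unfold qc₃; rw [pt₃_mk ha]; exact symmDiff_eq_union_fibre ha
  have e2 : qc₂ τ Q (u, (Q \ u) \ a) = ((Q \ u) \ (a ∆ ((τ ∩ Q) \ u))) ∪ ((τ ∩ Q) ∩ u) := by
    unfold qc₂; exact sdiff_symmDiff_eq_union_fibre a hT
  rw [e3, e2]
  simp only [mem_shiftFam]
  congr 1 <;> exact indZ_congr ⟨fun h => ⟨h.2, h.1⟩, fun h => ⟨h.2, h.1⟩⟩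

/-- The fibre identity with a weight on the first part. [this work] -/
theorem sum_top_sub_two_eq_sum_klCube_w (𝔄 𝔅 : Set (Set ι)) (ω : Set ι → ℤ) :
    ∑ P ∈ cfgsIn Q, ω (qc₁ τ Q P ∆ (τ ∩ Q)) * (indZ (qc₃ τ Q P ∈ 𝔄 ∧ qc₃ τ Q P ∈ 𝔅) - indZ (qc₂ τ Q P ∈ 𝔄 ∧ qc₃ τ Q P ∈ 𝔅))
      = ∑ u ∈ subsetsOf Q, ω u * klCube (shiftFam (τ ∩ Q) u 𝔅) (shiftFam (τ ∩ Q) u 𝔄) (Q \ u) := by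
  rw [sum_cfgsIn_eq_patSum]
  unfold patSum
  refine sum_congr rfl fun u hu => ?_
  rw [mem_subsetsOf] at hu
  dsimp only
  have e1 : ∀ a, qc₁ τ Q (u, (Q \ u) \ a) ∆ (τ ∩ Q) = u := fun a => by unfold qc₁; exact symmDiff_symmDiff_cancel_right _ _
  simp_rw [e1]
  rw [← mul_sum, klCube_eq_sum]
  congr 1
  have hT : τ ∩ Q ⊆ Q := Set.inter_subset_right
  have hS : (τ ∩ Q) \ u ⊆ Q \ u := Set.sdiff_subset_sdiff_left hT
  rw [← sum_subsetsOf_symmDiff (Q \ u) ((τ ∩ Q) \ u) hS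
    (fun a => indZ (a ∈ shiftFam (τ ∩ Q) u 𝔅 ∧ a ∈ shiftFam (τ ∩ Q) u 𝔄) - indZ (a ∈ shiftFam (τ ∩ Q) u 𝔅 ∧ (Q \ u) \ a ∈ shiftFam (τ ∩ Q) u 𝔄))]
  refine sum_congr rfl fun a ha => ?_
  rw [mem_subsetsOf] at ha
  have e3 : qc₃ τ Q (u, (Q \ u) \ a) = (a ∆ ((τ ∩ Q) \ u)) ∪ ((τ ∩ Q) ∩ u) := by
    unfold qc₃; rw [pt₃_mk ha]; exact symmDiff_eq_union_fibre ha
  have e2 : qc₂ τ Q (u, (Q \ u) \ a) = ((Q \ u) \ (a ∆ ((τ ∩ Q) \ u))) ∪ ((τ ∩ Q) ∩ u) := by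
    unfold qc₂; exact sdiff_symmDiff_eq_union_fibre a hT
  rw [e3, e2]
  simp only [mem_shiftFam]
  congr 1 <;> exact indZ_congr ⟨fun h => ⟨h.2, h.1⟩, fun h => ⟨h.2, h.1⟩⟩

end Fibre

end Summit.CriticalPhenomena.PercolationContinuityZ3.Theorems.ThreePartition

end
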